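import Summits.KontsevichZagierPeriods.KontsevichZagierPeriods.Theorems.K2SymbolChainsJensenIsScissorsRadialAux
import Summits.KontsevichZagierPeriods.KontsevichZagierPeriods.Theorems.K2SymbolChainsJensenIsScissorsBand

/-!
# Jensen is scissors — the radial step, core (part 1): the two pull-backs along `r`

Support file for item stmt-KontsevichZagierPeriods-5204 (`JensenIsScissors`, route
KontsevichZagierPeriods/K2SymbolChains). Over the base `T' = {(x, s) | x ∈ B, s ≠ 0}` (`0 < ρ < 1`
on `B`, `ρ` differentiable, `h` and `h log ρ` integrable) let `G = h(x)/(1 + s²)`,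
`W_r(s) = ((1 − r)² + (1 + r)² s²)/(1 + s²)` and `M = (1 + ρ)²`. The band representation
`[{W_{ρ²} < u < M W_ρ}, G/u]` and the unfolding `[{1 < u < M}, G/u]` of `G log M` differ by an
element of any subgroup `S` containing the three scissors move sets. Chain (all in dimension
`n + 2`, coordinates `(x, s, r)` / `(x, s, u)`): pull the band back along the monotone path
`u = F(r) = ((1 − ρ²)/(1 − r))² W_r(s)`, `r ∈ (ρ², ρ)` (rule 2)), obtaining the integrand
`G ∂ᵣ log F = 2G/(1 − r) + G/r − h c/((1 + c²s²) r)`, `c = (1 + r)/(1 − r)` (file `RadialAux`);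
split it (rule 1b)); `[2G/(1 − r)]` is the pull-back of `[{1 < u < M}, G/u]` along
`u = ((1 − ρ²)/(1 − r))²`, `[G/r]` that of the unfolding of `G log (1/ρ)` along `u = r/ρ²`
(rule 2)), and `[h c/((1 + c² s²) r)]` is carried onto `[G/r]` by the dilation `s ↦ c(r) s`
(rule 2) after swapping the coordinates `s`, `r`, a permutation move). [Kontsevich–Zagier 2001,
§1.2, rules 1)–2)] [folklore]
-/

noncomputable section

open MeasureTheory Set
open Literature.NumberTheory.Transcendental Literature.ModelTheory.ExponentialFields

namespace Summit.KontsevichZagierPeriods.K2SymbolChains.JensenIsScissorsProof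

open Literature.NumberTheory.Transcendental.KZ

variable {n : ℕ} {S : AddSubgroup FormalRep}

/-- **Radial core, part 1**: the pull-back `Rfull` of the band along the path `u = F(r)` and the
pull-back `Q₁` of `[{1 < u < M}, G/u]` along `u = ((1 − ρ²)/(1 − r))²` (both rule 2)). See the
module docstring. [Kontsevich–Zagier 2001, §1.2] [folklore] -/
theorem radial_pullbacks (hS : domainAddRel ∪ integrandAddRel ∪ changeOfVariablesRel ⊆ S)
    {B : Set (Fin n → ℝ)} {h ρ : (Fin n → ℝ) → ℝ}
    (hB : IsSemialgebraic ℚ B) (hh : IsSemialgebraicFunOn ℚ B h) (hρs : IsSemialgebraicFunOn ℚ B ρ)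
    (hρ0 : ∀ x ∈ B, 0 < ρ x) (hρ1 : ∀ x ∈ B, ρ x < 1) (hρd : ∀ x ∈ B, DifferentiableAt ℝ ρ x)
    (Rband LM : IntegralRep (n + 1 + 1))
    (hBd : Rband.domain = {z : Fin (n + 1 + 1) → ℝ |
      Fin.init z ∈ {b : Fin (n + 1) → ℝ | Fin.init b ∈ B ∧ b (Fin.last n) ≠ 0} ∧
      ((1 - ρ (Fin.init (Fin.init z)) ^ 2) ^ 2 + (1 + ρ (Fin.init (Fin.init z)) ^ 2) ^ 2 *
          (Fin.init z) (Fin.last n) ^ 2) / (1 + (Fin.init z) (Fin.last n) ^ 2) < z (Fin.last (n + 1)) ∧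
      z (Fin.last (n + 1)) < (1 + ρ (Fin.init (Fin.init z))) ^ 2 *
        (((1 - ρ (Fin.init (Fin.init z))) ^ 2 + (1 + ρ (Fin.init (Fin.init z))) ^ 2 *
          (Fin.init z) (Fin.last n) ^ 2) / (1 + (Fin.init z) (Fin.last n) ^ 2))})
    (hBi : Rband.integrand = fun z => (h (Fin.init (Fin.init z)) / (1 + (Fin.init z) (Fin.last n) ^ 2)) /
      z (Fin.last (n + 1)))
    (hMd : LM.domain = logUnfoldDomain {b : Fin (n + 1) → ℝ | Fin.init b ∈ B ∧ b (Fin.last n) ≠ 0}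
      (fun b => (1 + ρ (Fin.init b)) ^ 2))
    (hMi : LM.integrand = logUnfoldIntegrand (fun b => h (Fin.init b) / (1 + b (Fin.last n) ^ 2))) :
    ∃ Rfull Q₁ : IntegralRep (n + 1 + 1),
      Rfull.domain = {z : Fin (n + 1 + 1) → ℝ |
        Fin.init z ∈ {b : Fin (n + 1) → ℝ | Fin.init b ∈ B ∧ b (Fin.last n) ≠ 0} ∧
        ρ (Fin.init (Fin.init z)) ^ 2 < z (Fin.last (n + 1)) ∧ z (Fin.last (n + 1)) < ρ (Fin.init (Fin.init z))} ∧
      Rfull.integrand = (fun z : Fin (n + 1 + 1) → ℝ =>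
        h (Fin.init (Fin.init z)) * (2 / (1 - z (Fin.last (n + 1))) / (1 + (Fin.init z) (Fin.last n) ^ 2)) +
        h (Fin.init (Fin.init z)) / (1 + (Fin.init z) (Fin.last n) ^ 2) / z (Fin.last (n + 1)) -
        h (Fin.init (Fin.init z)) * ((1 + z (Fin.last (n + 1))) / (1 - z (Fin.last (n + 1)))) /
          ((1 + ((1 + z (Fin.last (n + 1))) / (1 - z (Fin.last (n + 1)))) ^ 2 * (Fin.init z) (Fin.last n) ^ 2) *
            z (Fin.last (n + 1)))) ∧
      of Rfull - of Rband ∈ S ∧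
      Q₁.domain = {z : Fin (n + 1 + 1) → ℝ |
        Fin.init z ∈ {b : Fin (n + 1) → ℝ | Fin.init b ∈ B ∧ b (Fin.last n) ≠ 0} ∧
        ρ (Fin.init (Fin.init z)) ^ 2 < z (Fin.last (n + 1)) ∧ z (Fin.last (n + 1)) < ρ (Fin.init (Fin.init z))} ∧
      Q₁.integrand = (fun z : Fin (n + 1 + 1) → ℝ =>
        h (Fin.init (Fin.init z)) / (1 + (Fin.init z) (Fin.last n) ^ 2) * (2 / (1 - z (Fin.last (n + 1))))) ∧
      of Q₁ - of LM ∈ S := by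
  -- notation
  set T' : Set (Fin (n + 1) → ℝ) := {b | Fin.init b ∈ B ∧ b (Fin.last n) ≠ 0} with hT'_def
  set G : (Fin (n + 1) → ℝ) → ℝ := fun b => h (Fin.init b) / (1 + b (Fin.last n) ^ 2) with hG_def
  set W : (Fin (n + 1) → ℝ) → ℝ := fun b =>
    ((1 - ρ (Fin.init b)) ^ 2 + (1 + ρ (Fin.init b)) ^ 2 * b (Fin.last n) ^ 2) / (1 + b (Fin.last n) ^ 2)
    with hW_def
  set W₂ : (Fin (n + 1) → ℝ) → ℝ := fun b =>
    ((1 - ρ (Fin.init b) ^ 2) ^ 2 + (1 + ρ (Fin.init b) ^ 2) ^ 2 * b (Fin.last n) ^ 2) /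
      (1 + b (Fin.last n) ^ 2) with hW₂_def
  set M : (Fin (n + 1) → ℝ) → ℝ := fun b => (1 + ρ (Fin.init b)) ^ 2 with hM_def
  -- the path `F` on `E = {(b, r) | b ∈ T', ρ² < r < ρ}` and its endpoints
  set Ff : (Fin (n + 1 + 1) → ℝ) → ℝ := fun z =>
    (1 - ρ (Fin.init (Fin.init z)) ^ 2) ^ 2 * ((1 - z (Fin.last (n + 1))) ^ 2 +
      (1 + z (Fin.last (n + 1))) ^ 2 * (Fin.init z) (Fin.last n) ^ 2) /
      ((1 - z (Fin.last (n + 1))) ^ 2 * (1 + (Fin.init z) (Fin.last n) ^ 2)) with hFf_def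
  set p : (Fin (n + 1) → ℝ) → ℝ := fun b => ρ (Fin.init b) ^ 2 with hp_def
  set q : (Fin (n + 1) → ℝ) → ℝ := fun b => ρ (Fin.init b) with hq_def
  set E : Set (Fin (n + 1 + 1) → ℝ) := {z | Fin.init z ∈ T' ∧ p (Fin.init z) < z (Fin.last (n + 1)) ∧
    z (Fin.last (n + 1)) < q (Fin.init z)} with hE_def
  -- basic facts
  have hT : IsSemialgebraic ℚ {b : Fin (n + 1) → ℝ | Fin.init b ∈ B} := isSemialgebraic_cyl hB
  have hsT := isSemialgebraicFunOn_apply hT (Fin.last n)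
  have hT's : IsSemialgebraic ℚ T' := hsT.isSemialgebraic_sep_ne_zero
  have hT'B : T' ⊆ {b : Fin (n + 1) → ℝ | Fin.init b ∈ B} := fun b hb => hb.1
  have hps : IsSemialgebraicFunOn ℚ T' p :=
    ((IsSemialgebraicFunOn.mul_holds hρs hρs).comp_init.mono hT'B hT's).congr fun b _ => by
      simp only [hp_def, Pi.mul_apply, sq]
  have hqs : IsSemialgebraicFunOn ℚ T' q := hρs.comp_init.mono hT'B hT's
  have hpq : ∀ b ∈ T', p b ≤ q b := fun b hb => by
    have h0 := hρ0 _ hb.1; have h1 := hρ1 _ hb.1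
    simp only [hp_def, hq_def]; nlinarith
  have hEs : IsSemialgebraic ℚ E := isSemialgebraic_oband hps hqs
  have hGT' : IsSemialgebraicFunOn ℚ T' G := isSemialgebraicFunOn_weight hh hT's hT'B
  have hMs : IsSemialgebraicFunOn ℚ T' M := by
    have h1 := IsSemialgebraicFunOn.add_holds (isSemialgebraicFunOn_ratCast hT's 1) hqs
    exact (IsSemialgebraicFunOn.mul_holds h1 h1).congr fun b _ => by simp [hM_def, hq_def, sq]
  have hM1 : ∀ b ∈ T', 1 ≤ M b := fun b hb => by
    have := hρ0 _ hb.1; simp only [hM_def]; nlinarith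
  -- facts on `E`: write `x = init (init z)`, `s = (init z) last`, `r = z last`
  have hEx : ∀ z ∈ E, Fin.init (Fin.init z) ∈ B := fun z hz => hz.1.1
  have hEs0 : ∀ z ∈ E, (Fin.init z) (Fin.last n) ≠ 0 := fun z hz => hz.1.2
  have hEr0 : ∀ z ∈ E, 0 < z (Fin.last (n + 1)) := fun z hz =>
    lt_trans (by have := hρ0 _ hz.1.1; simp only [hp_def]; positivity) hz.2.1
  have hEr1 : ∀ z ∈ E, z (Fin.last (n + 1)) < 1 := fun z hz => hz.2.2.trans (hρ1 _ hz.1.1)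
  -- semialgebraic atoms on `E`
  have hρE : IsSemialgebraicFunOn ℚ E (fun z => ρ (Fin.init (Fin.init z))) :=
    hρs.comp_init.comp_init.mono (fun z hz => hEx z hz) hEs
  have hhE : IsSemialgebraicFunOn ℚ E (fun z => h (Fin.init (Fin.init z))) :=
    hh.comp_init.comp_init.mono (fun z hz => hEx z hz) hEs
  have hsE : IsSemialgebraicFunOn ℚ E (fun z : Fin (n + 1 + 1) → ℝ => (Fin.init z) (Fin.last n)) :=
    (isSemialgebraicFunOn_apply hEs (Fin.castSucc (Fin.last n))).congr fun z _ => by simp [Fin.init]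
  have hrE : IsSemialgebraicFunOn ℚ E (fun z : Fin (n + 1 + 1) → ℝ => z (Fin.last (n + 1))) :=
    isSemialgebraicFunOn_apply hEs (Fin.last (n + 1))
  have h1E := isSemialgebraicFunOn_ratCast hEs 1
  have h2E := isSemialgebraicFunOn_ratCast hEs 2
  have h1s2 : IsSemialgebraicFunOn ℚ E (fun z : Fin (n + 1 + 1) → ℝ => 1 + (Fin.init z) (Fin.last n) ^ 2) :=
    (IsSemialgebraicFunOn.add_holds h1E (IsSemialgebraicFunOn.mul_holds hsE hsE)).congr fun z _ => by simp [sq]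
  have h1mr : IsSemialgebraicFunOn ℚ E (fun z : Fin (n + 1 + 1) → ℝ => 1 - z (Fin.last (n + 1))) :=
    (IsSemialgebraicFunOn.sub_holds h1E hrE).congr fun z _ => by simp
  have h1pr : IsSemialgebraicFunOn ℚ E (fun z : Fin (n + 1 + 1) → ℝ => 1 + z (Fin.last (n + 1))) :=
    (IsSemialgebraicFunOn.add_holds h1E hrE).congr fun z _ => by simp
  have hcE : IsSemialgebraicFunOn ℚ E (fun z : Fin (n + 1 + 1) → ℝ =>
      (1 + z (Fin.last (n + 1))) / (1 - z (Fin.last (n + 1)))) :=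
    IsSemialgebraicFunOn.div h1pr h1mr fun z hz => by have := hEr1 z hz; exact by linarith
  -- differentiable atoms at points of `E`
  have hdiff_atoms : ∀ z ∈ E,
      DifferentiableAt ℝ (fun z : Fin (n + 1 + 1) → ℝ => ρ (Fin.init (Fin.init z))) z ∧
      DifferentiableAt ℝ (fun z : Fin (n + 1 + 1) → ℝ => (Fin.init z) (Fin.last n)) z ∧
      DifferentiableAt ℝ (fun z : Fin (n + 1 + 1) → ℝ => z (Fin.last (n + 1))) z := by
    intro z hz
    have hi1 : DifferentiableAt ℝ (fun w : Fin (n + 1 + 1) → ℝ => Fin.init w) z :=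
      (ContinuousLinearMap.pi fun j => ContinuousLinearMap.proj (R := ℝ)
        (φ := fun _ : Fin (n + 1 + 1) => ℝ) (Fin.castSucc j)).differentiableAt
    have hi2 : DifferentiableAt ℝ (fun w : Fin (n + 1) → ℝ => Fin.init w) (Fin.init z) :=
      (ContinuousLinearMap.pi fun j => ContinuousLinearMap.proj (R := ℝ)
        (φ := fun _ : Fin (n + 1) => ℝ) (Fin.castSucc j)).differentiableAt
    refine ⟨((hρd _ (hEx z hz)).comp _ hi2).comp z hi1, ?_, differentiableAt_apply (𝕜 := ℝ) _ z⟩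
    exact (differentiableAt_apply (𝕜 := ℝ) (Fin.last n) (Fin.init z)).comp z hi1
  ----------------------------------------------------------------
  -- C1: pull the band back along the path `u = F(r)`
  ----------------------------------------------------------------
  have hFs : IsSemialgebraicFunOn ℚ E Ff := by
    have hK : IsSemialgebraicFunOn ℚ E (fun z => (1 - ρ (Fin.init (Fin.init z)) ^ 2) ^ 2) := by
      have h1 := IsSemialgebraicFunOn.sub_holds h1E (IsSemialgebraicFunOn.mul_holds hρE hρE)
      exact (IsSemialgebraicFunOn.mul_holds h1 h1).congr fun z _ => by simp [sq]
    have hnum : IsSemialgebraicFunOn ℚ E (fun z : Fin (n + 1 + 1) → ℝ => (1 - z (Fin.last (n + 1))) ^ 2 +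
        (1 + z (Fin.last (n + 1))) ^ 2 * (Fin.init z) (Fin.last n) ^ 2) :=
      (IsSemialgebraicFunOn.add_holds (IsSemialgebraicFunOn.mul_holds h1mr h1mr)
        (IsSemialgebraicFunOn.mul_holds (IsSemialgebraicFunOn.mul_holds h1pr h1pr)
          (IsSemialgebraicFunOn.mul_holds hsE hsE))).congr fun z _ => by simp [sq]
    have hden : IsSemialgebraicFunOn ℚ E (fun z : Fin (n + 1 + 1) → ℝ => (1 - z (Fin.last (n + 1))) ^ 2 *
        (1 + (Fin.init z) (Fin.last n) ^ 2)) :=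
      (IsSemialgebraicFunOn.mul_holds (IsSemialgebraicFunOn.mul_holds h1mr h1mr) h1s2).congr fun z _ => by simp [sq]
    refine (IsSemialgebraicFunOn.div (IsSemialgebraicFunOn.mul_holds hK hnum) hden fun z hz => ?_).congr
      fun z _ => by simp only [hFf_def, Pi.mul_apply]
    have := hEr1 z hz
    have h1 : (1 - z (Fin.last (n + 1))) ≠ 0 := by linarith
    positivity
  have hFd : ∀ z ∈ E, DifferentiableAt ℝ Ff z := fun z hz => by
    obtain ⟨dρ, ds, dr⟩ := hdiff_atoms z hz
    have h1 : (1 - z (Fin.last (n + 1))) ≠ 0 := by have := hEr1 z hz; linarith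
    have hden : DifferentiableAt ℝ (fun z : Fin (n + 1 + 1) → ℝ => (1 - z (Fin.last (n + 1))) ^ 2 *
        (1 + (Fin.init z) (Fin.last n) ^ 2)) z :=
      (((differentiableAt_const _).sub dr).pow 2).mul ((differentiableAt_const _).add (ds.pow 2))
    simp only [hFf_def, div_eq_mul_inv]
    refine (((((differentiableAt_const _).sub (dρ.pow 2)).pow 2).mul ?_).mul (hden.inv ?_))
    · exact (((differentiableAt_const _).sub dr).pow 2).add ((((differentiableAt_const _).add dr).pow 2).mul (ds.pow 2))
    · positivity
  have hFsnoc : ∀ (b : Fin (n + 1) → ℝ) (t : ℝ), Ff (Fin.snoc b t) =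
      (1 - ρ (Fin.init b) ^ 2) ^ 2 * ((1 - t) ^ 2 + (1 + t) ^ 2 * b (Fin.last n) ^ 2) /
        ((1 - t) ^ 2 * (1 + b (Fin.last n) ^ 2)) := fun b t => by
    simp only [hFf_def, Fin.init_snoc, Fin.snoc_last]
  have hFcont : ∀ b ∈ T', ContinuousOn (fun t : ℝ => Ff (Fin.snoc b t)) (Icc (p b) (q b)) := fun b hb => by
    simp only [hFsnoc, hp_def, hq_def]
    exact radF_continuousOn (hρ1 _ hb.1)
  have hFmono : ∀ b ∈ T', StrictMonoOn (fun t : ℝ => Ff (Fin.snoc b t)) (Icc (p b) (q b)) := fun b hb => by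
    simp only [hFsnoc, hp_def, hq_def]
    exact radF_strictMonoOn (hρ0 _ hb.1) (hρ1 _ hb.1) hb.2
  have hFleft : ∀ b ∈ T', Ff (Fin.snoc b (p b)) = W₂ b := fun b hb => by
    rw [hFsnoc]
    simp only [hp_def, hW₂_def]
    have : ρ (Fin.init b) ^ 2 ≠ 1 := by have := hρ0 _ hb.1; have := hρ1 _ hb.1; nlinarith
    exact radF_left this
  have hFright : ∀ b ∈ T', Ff (Fin.snoc b (q b)) = M b * W b := fun b hb => by
    rw [hFsnoc]
    simp only [hq_def, hW_def, hM_def]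
    exact radF_right (hρ1 _ hb.1).ne
  have hBd' : Rband.domain = {z : Fin (n + 1 + 1) → ℝ | Fin.init z ∈ T' ∧
      Ff (Fin.snoc (Fin.init z) (p (Fin.init z))) < z (Fin.last (n + 1)) ∧
        z (Fin.last (n + 1)) < Ff (Fin.snoc (Fin.init z) (q (Fin.init z)))} := by
    rw [hBd]
    ext z
    simp only [mem_setOf_eq]
    constructor
    · rintro ⟨hb, h1, h2⟩
      exact ⟨hb, by rw [hFleft _ hb]; exact h1, by rw [hFright _ hb]; exact h2⟩
    · rintro ⟨hb, h1, h2⟩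
      exact ⟨hb, by rw [hFleft _ hb] at h1; exact h1, by rw [hFright _ hb] at h2; exact h2⟩
  -- the derivative of the path along `r` and its sign
  have hFderiv : ∀ z ∈ E, fderiv ℝ Ff z (Pi.single (Fin.last (n + 1)) 1) =
      (1 - ρ (Fin.init (Fin.init z)) ^ 2) ^ 2 / (1 + (Fin.init z) (Fin.last n) ^ 2) *
        (((2 * (1 + (Fin.init z) (Fin.last n) ^ 2) * z (Fin.last (n + 1)) + 2 * ((Fin.init z) (Fin.last n) ^ 2 - 1)) *
          (1 - z (Fin.last (n + 1))) ^ 2 -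
          ((1 + (Fin.init z) (Fin.last n) ^ 2) * z (Fin.last (n + 1)) ^ 2 +
            2 * ((Fin.init z) (Fin.last n) ^ 2 - 1) * z (Fin.last (n + 1)) + (1 + (Fin.init z) (Fin.last n) ^ 2)) *
          (2 * z (Fin.last (n + 1)) - 2)) / ((1 - z (Fin.last (n + 1))) ^ 2) ^ 2) := fun z hz => by
    refine fderiv_apply_single_last (hFd z hz).hasFDerivAt ?_
    have h := hasDerivAt_radF (ρ (Fin.init (Fin.init z))) ((Fin.init z) (Fin.last n)) (hEr1 z hz).ne
    simp only [hFsnoc] at h ⊢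
    convert h using 2
  have hDpos : ∀ z ∈ E, 0 < (1 - ρ (Fin.init (Fin.init z)) ^ 2) ^ 2 / (1 + (Fin.init z) (Fin.last n) ^ 2) *
        (((2 * (1 + (Fin.init z) (Fin.last n) ^ 2) * z (Fin.last (n + 1)) + 2 * ((Fin.init z) (Fin.last n) ^ 2 - 1)) *
          (1 - z (Fin.last (n + 1))) ^ 2 -
          ((1 + (Fin.init z) (Fin.last n) ^ 2) * z (Fin.last (n + 1)) ^ 2 +
            2 * ((Fin.init z) (Fin.last n) ^ 2 - 1) * z (Fin.last (n + 1)) + (1 + (Fin.init z) (Fin.last n) ^ 2)) *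
          (2 * z (Fin.last (n + 1)) - 2)) / ((1 - z (Fin.last (n + 1))) ^ 2) ^ 2) := fun z hz => by
    set s := (Fin.init z) (Fin.last n)
    set r := z (Fin.last (n + 1))
    have hr1 := hEr1 z hz; have hr0 := hEr0 z hz; have hs := hEs0 z hz
    have hρx : ρ (Fin.init (Fin.init z)) ^ 2 < 1 := by
      have := hρ0 _ (hEx z hz); have := hρ1 _ (hEx z hz); nlinarith
    have hnum : ((2 * (1 + s ^ 2) * r + 2 * (s ^ 2 - 1)) * (1 - r) ^ 2 -
        ((1 + s ^ 2) * r ^ 2 + 2 * (s ^ 2 - 1) * r + (1 + s ^ 2)) * (2 * r - 2)) =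
        4 * s ^ 2 * (1 - r) * (1 + r) := by ring
    rw [hnum]
    have h1 : 0 < 1 - r := by linarith
    have h2 : 0 < 1 + r := by linarith
    have h3' : 0 < 1 - ρ (Fin.init (Fin.init z)) ^ 2 := by linarith
    have h3 : 0 < (1 - ρ (Fin.init (Fin.init z)) ^ 2) ^ 2 := by positivity
    have h4 : 0 < s ^ 2 := by positivity
    positivity
  -- the pulled-back integrand
  set fR : (Fin (n + 1 + 1) → ℝ) → ℝ := fun z =>
    h (Fin.init (Fin.init z)) * (2 / (1 - z (Fin.last (n + 1))) / (1 + (Fin.init z) (Fin.last n) ^ 2)) +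
      h (Fin.init (Fin.init z)) / (1 + (Fin.init z) (Fin.last n) ^ 2) / z (Fin.last (n + 1)) -
      h (Fin.init (Fin.init z)) * ((1 + z (Fin.last (n + 1))) / (1 - z (Fin.last (n + 1)))) /
        ((1 + ((1 + z (Fin.last (n + 1))) / (1 - z (Fin.last (n + 1)))) ^ 2 * (Fin.init z) (Fin.last n) ^ 2) *
          z (Fin.last (n + 1))) with hfR_def
  have hfRs : IsSemialgebraicFunOn ℚ E fR := by
    have hr0' : ∀ z ∈ E, z (Fin.last (n + 1)) ≠ 0 := fun z hz => (hEr0 z hz).ne'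
    have t1 : IsSemialgebraicFunOn ℚ E (fun z : Fin (n + 1 + 1) → ℝ =>
        h (Fin.init (Fin.init z)) * (2 / (1 - z (Fin.last (n + 1))) / (1 + (Fin.init z) (Fin.last n) ^ 2))) :=
      IsSemialgebraicFunOn.mul_holds hhE (IsSemialgebraicFunOn.div (IsSemialgebraicFunOn.div h2E h1mr
        fun z hz => by have := hEr1 z hz; exact by linarith) h1s2 fun z _ => by positivity)
    have t2 : IsSemialgebraicFunOn ℚ E (fun z : Fin (n + 1 + 1) → ℝ =>
        h (Fin.init (Fin.init z)) / (1 + (Fin.init z) (Fin.last n) ^ 2) / z (Fin.last (n + 1))) :=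
      IsSemialgebraicFunOn.div (IsSemialgebraicFunOn.div hhE h1s2 fun z _ => by positivity) hrE hr0'
    have t3 : IsSemialgebraicFunOn ℚ E (fun z : Fin (n + 1 + 1) → ℝ =>
        h (Fin.init (Fin.init z)) * ((1 + z (Fin.last (n + 1))) / (1 - z (Fin.last (n + 1)))) /
          ((1 + ((1 + z (Fin.last (n + 1))) / (1 - z (Fin.last (n + 1)))) ^ 2 * (Fin.init z) (Fin.last n) ^ 2) *
            z (Fin.last (n + 1)))) := by
      refine IsSemialgebraicFunOn.div (IsSemialgebraicFunOn.mul_holds hhE hcE)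
        ((IsSemialgebraicFunOn.mul_holds (IsSemialgebraicFunOn.add_holds h1E
          (IsSemialgebraicFunOn.mul_holds (IsSemialgebraicFunOn.mul_holds hcE hcE)
            (IsSemialgebraicFunOn.mul_holds hsE hsE))) hrE).congr fun z _ => by simp [sq]) fun z hz => ?_
      have := hEr0 z hz
      positivity
    exact (IsSemialgebraicFunOn.sub_holds (IsSemialgebraicFunOn.add_holds t1 t2) t3).congr fun z _ => by
      simp only [hfR_def, Pi.add_apply, Pi.sub_apply]
  obtain ⟨Rfull, hRfd, hRfi, eFull⟩ := exists_preimage_lastCoord hS hps hqs hpq Rband hFs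
    (F' := fun z => fderiv ℝ Ff z) (fun z hz => (hFd z hz).hasFDerivAt) hFcont hFmono hBd' hfRs
    (fun z hz => by
      rw [hBi, hFderiv z hz, abs_of_pos (hDpos z hz)]
      simp only [Fin.init_snoc, Fin.snoc_last, hFf_def]
      have hW : (1 - z (Fin.last (n + 1))) ^ 2 + (1 + z (Fin.last (n + 1))) ^ 2 * (Fin.init z) (Fin.last n) ^ 2 ≠ 0 :=
        (W_num_pos_of_ne (hEs0 z hz) (by have := hEr0 z hz; linarith)).ne'
      have hρx : ρ (Fin.init (Fin.init z)) ^ 2 ≠ 1 := by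
        have := hρ0 _ (hEx z hz); have := hρ1 _ (hEx z hz); nlinarith
      exact (radF_logDeriv (h (Fin.init (Fin.init z))) _ _ (hEr0 z hz).ne' (hEr1 z hz).ne hρx hW).symm)
  ----------------------------------------------------------------
  -- C2: `[2G/(1 − r)]` is the pull-back of `LM` along `u = ((1 − ρ²)/(1 − r))²`
  ----------------------------------------------------------------
  set Fm : (Fin (n + 1 + 1) → ℝ) → ℝ := fun z =>
    ((1 - ρ (Fin.init (Fin.init z)) ^ 2) / (1 - z (Fin.last (n + 1)))) ^ 2 with hFm_def
  have hFms : IsSemialgebraicFunOn ℚ E Fm := by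
    have h1 := IsSemialgebraicFunOn.div (IsSemialgebraicFunOn.sub_holds h1E (IsSemialgebraicFunOn.mul_holds hρE hρE))
      h1mr fun z hz => by have := hEr1 z hz; exact by linarith
    exact (IsSemialgebraicFunOn.mul_holds h1 h1).congr fun z _ => by simp [hFm_def, sq]
  have hFmd : ∀ z ∈ E, DifferentiableAt ℝ Fm z := fun z hz => by
    obtain ⟨dρ, -, dr⟩ := hdiff_atoms z hz
    have h1 : (1 - z (Fin.last (n + 1))) ≠ 0 := by have := hEr1 z hz; linarith
    simp only [hFm_def, div_eq_mul_inv]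
    exact (((differentiableAt_const _).sub (dρ.pow 2)).mul (((differentiableAt_const _).sub dr).inv h1)).pow 2
  have hFmsnoc : ∀ (b : Fin (n + 1) → ℝ) (t : ℝ), Fm (Fin.snoc b t) = ((1 - ρ (Fin.init b) ^ 2) / (1 - t)) ^ 2 :=
    fun b t => by simp only [hFm_def, Fin.init_snoc, Fin.snoc_last]
  have hFmderiv : ∀ z ∈ E, fderiv ℝ Fm z (Pi.single (Fin.last (n + 1)) 1) =
      2 * ((1 - ρ (Fin.init (Fin.init z)) ^ 2) / (1 - z (Fin.last (n + 1)))) *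
        ((1 - ρ (Fin.init (Fin.init z)) ^ 2) / (1 - z (Fin.last (n + 1))) ^ 2) := fun z hz => by
    refine fderiv_apply_single_last (hFmd z hz).hasFDerivAt ?_
    have h := hasDerivAt_radM (ρ (Fin.init (Fin.init z))) (hEr1 z hz).ne
    simp only [hFmsnoc] at h ⊢
    convert h using 2
  have hMd' : LM.domain = {z : Fin (n + 1 + 1) → ℝ | Fin.init z ∈ T' ∧
      Fm (Fin.snoc (Fin.init z) (p (Fin.init z))) < z (Fin.last (n + 1)) ∧
        z (Fin.last (n + 1)) < Fm (Fin.snoc (Fin.init z) (q (Fin.init z)))} := by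
    rw [hMd, logUnfoldDomain_eq_of_one_le hM1]
    ext z
    simp only [mem_setOf_eq]
    constructor
    · rintro ⟨hb, h1, h2⟩
      obtain ⟨e1, e2⟩ := radM_endpoints (hρ0 _ hb.1).le (hρ1 _ hb.1)
      refine ⟨hb, ?_, ?_⟩
      · rw [hFmsnoc]; simp only [hp_def]; rw [e1]; exact h1
      · rw [hFmsnoc]; simp only [hq_def]; rw [e2]; exact h2
    · rintro ⟨hb, h1, h2⟩
      obtain ⟨e1, e2⟩ := radM_endpoints (hρ0 _ hb.1).le (hρ1 _ hb.1)
      refine ⟨hb, ?_, ?_⟩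
      · rw [hFmsnoc] at h1; simp only [hp_def] at h1; rw [e1] at h1; exact h1
      · rw [hFmsnoc] at h2; simp only [hq_def] at h2; rw [e2] at h2; exact h2
  set f₁ : (Fin (n + 1 + 1) → ℝ) → ℝ := fun z =>
    h (Fin.init (Fin.init z)) / (1 + (Fin.init z) (Fin.last n) ^ 2) * (2 / (1 - z (Fin.last (n + 1))))
    with hf₁_def
  have hf₁s : IsSemialgebraicFunOn ℚ E f₁ :=
    IsSemialgebraicFunOn.mul_holds (IsSemialgebraicFunOn.div hhE h1s2 fun z _ => by positivity)
      (IsSemialgebraicFunOn.div h2E h1mr fun z hz => by have := hEr1 z hz; exact by linarith)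
  have hFm1 : ∀ z ∈ E, 1 < Fm z := fun z hz => by
    have hb : Fin.init z ∈ T' := hz.1
    obtain ⟨e1, -⟩ := radM_endpoints (hρ0 _ hb.1).le (hρ1 _ hb.1)
    have hm := radM_strictMonoOn (hρ0 _ hb.1) (hρ1 _ hb.1) ⟨le_rfl, hpq _ hb⟩ ⟨hz.2.1.le, hz.2.2.le⟩ hz.2.1
    simp only at hm
    rw [e1] at hm
    rw [← Fin.snoc_init_self z, hFmsnoc]
    exact hm
  obtain ⟨Q₁, hQ₁d, hQ₁i, eQ₁⟩ := exists_preimage_lastCoord hS hps hqs hpq LM hFms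
    (F' := fun z => fderiv ℝ Fm z) (fun z hz => (hFmd z hz).hasFDerivAt)
    (fun b hb => by simp only [hFmsnoc, hp_def, hq_def]; exact radM_continuousOn (hρ1 _ hb.1))
    (fun b hb => by simp only [hFmsnoc, hp_def, hq_def]; exact radM_strictMonoOn (hρ0 _ hb.1) (hρ1 _ hb.1))
    hMd' hf₁s
    (fun z hz => by
      have hρx : ρ (Fin.init (Fin.init z)) ^ 2 ≠ 1 := by
        have := hρ0 _ (hEx z hz); have := hρ1 _ (hEx z hz); nlinarith
      have hdpos : 0 < 2 * ((1 - ρ (Fin.init (Fin.init z)) ^ 2) / (1 - z (Fin.last (n + 1)))) *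
          ((1 - ρ (Fin.init (Fin.init z)) ^ 2) / (1 - z (Fin.last (n + 1))) ^ 2) := by
        have h1 : 0 < 1 - z (Fin.last (n + 1)) := by have := hEr1 z hz; linarith
        have h2 : 0 < 1 - ρ (Fin.init (Fin.init z)) ^ 2 := by
          have := hρ0 _ (hEx z hz); have := hρ1 _ (hEx z hz); nlinarith
        positivity
      rw [hMi, hFmderiv z hz, abs_of_pos hdpos, logUnfoldIntegrand]
      simp only [Fin.init_snoc, Fin.snoc_last]
      rw [if_pos (hFm1 z hz), one_mul]
      simp only [hFm_def, hf₁_def, hG_def]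
      exact (radM_weight _ _ (hEr1 z hz).ne hρx).symm)
  exact ⟨Rfull, Q₁, hRfd, hRfi, eFull, hQ₁d, hQ₁i, eQ₁⟩

end Summit.KontsevichZagierPeriods.K2SymbolChains.JensenIsScissorsProof
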